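import Summits.ResolutionOfSingularities.ResolutionOfSingularities.Theorems.ShadowsUniformize.Negative.IdentityShadow
import Literature.AlgebraicGeometry.Resolution.AffineDomainDimension
import HarnessLib

/-!
# `ShadowsUniformize`: the crux against the target, and the low-dimensional locus (lead c3)

Two structural facts about the crux `ShadowsUniformize` (stmt-ResolutionOfSingularities-16756,
route `AbhyankarShadows`), recorded for the planner by the line lead of cycle 4:

* `shadowsUniformize_iff_lurelRational_of_semivaluationShadows` — GIVEN the sister crux
  `SemivaluationShadows` (existence of shadows exact on every finite `F`), the transfer crux
  `ShadowsUniformize` is EQUIVALENT to the route target `LurelRational`: the route's `K1 ∧ K2`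
  decomposition types `K2` as "`K1`'s conclusion ⇒ target", so once `K1` holds `K2` carries the
  whole target. (The unconditional half `LurelRational → ShadowsUniformize` is the standing
  disprover's `not_lurelRational_of_not_shadowsUniformize`, contrapositively.)
* `lurel_of_trdeg_le_three` — modulo the tree's NAMED FACT `CossartPiltant2019LU3` (Cossart–Piltant
  2019, Thm. 1.1 in its local-uniformization form (LU), §4.1), relative local uniformization in
  the crux's affine-model shape holds at EVERY valuation ring of a function field of transcendence
  degree `≤ 3` (any residue field, any characteristic) — in particular the crux restricted to
  `trdeg K ≤ 3` holds conditionally, with the shadow hypothesis idle. So the open core of the birth line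
  (`Cruxes/ShadowsUniformize/Lines/birth.lean`, `stub_shadowFrameTransfer_core`) is, modulo that
  named fact, a statement about `trdeg K ≥ 4` only — where relative local uniformization in
  positive characteristic is open.

## Sources

* [CP19] V. Cossart, O. Piltant, *Resolution of singularities of arithmetical threefolds*,
  J. Algebra 529 (2019) 268–535: Thm. 1.1, §4.1 (LU). [CossartPiltant2019]
* [Te23] B. Teissier, arXiv:2311.12456, p. 5 (Conjecture). [Teissier2023]
-/

noncomputable section

-- single-problem summit: the doubled namespace component is forced
set_option linter.dupNamespace false

open Literature.AlgebraicGeometry.Resolution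
open Summit.ResolutionOfSingularities.ResolutionOfSingularities.Theses.AbhyankarShadows

namespace Summit.ResolutionOfSingularities.ResolutionOfSingularities.Theorems

/-- **Given shadows, the transfer crux is the target.** If every `(R, O)` admits shadows exact on
every finite `F` (the sister crux `SemivaluationShadows`), then `ShadowsUniformize ↔ LurelRational`:
forward by feeding the shadows into the transfer, backward by discarding the shadow hypothesis.
[cite: Teissier2023, p. 5 (Conjecture)] -/
theorem shadowsUniformize_iff_lurelRational_of_semivaluationShadows (h₁ : SemivaluationShadows) :
    ShadowsUniformize ↔ LurelRational :=
  ⟨fun h₂ p hp k K _ _ _ _ _ hfg O hO hrat R hR hRO =>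
      h₂ p hp k K hfg O hO hrat R hR hRO fun F => h₁ p hp k K hfg O hO hrat R hR hRO F,
    fun h p hp k K _ _ _ _ _ hfg O hO hrat R hR hRO _ => h p hp k K hfg O hO hrat R hR hRO⟩

/-- **Relative local uniformization in transcendence degree `≤ 3`, crux shape, modulo
Cossart–Piltant.** Under the named fact `CossartPiltant2019LU3`, for `K/k` finitely generated of
transcendence degree `≤ 3`, every valuation ring `O ∋ k` of `K` and every finitely generated
`R ⊆ O` admit a finitely generated `A` with `R ≤ A ⊆ O`, `Frac A = K`, regular at the centre of
`O`: enlarge `R` birationally inside `O` (`exists_fg_isFractionRing_le`) and apply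
`CossartPiltant2019LU3.relLocalUniformization`. CONDITIONAL on the named fact.
[cite: CossartPiltant2019, Thm. 1.1 with §4.1 (LU)] -/
theorem lurel_of_trdeg_le_three (hCP : CossartPiltant2019LU3.{0}) (k K : Type) [Field k]
    [Field K] [Algebra k K] (hfg : (⊤ : IntermediateField k K).FG) (hK : Algebra.trdeg k K ≤ 3)
    (O : ValuationSubring K) (hk : ∀ c : k, algebraMap k K c ∈ O)
    (R : Subalgebra k K) (hR : R.FG) (hRO : R.toSubring ≤ O.toSubring) :
    ∃ (A : Subalgebra k K) (h : A.toSubring ≤ O.toSubring), R ≤ A ∧ A.FG ∧ IsFractionRing A K ∧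
      IsRegularLocalRing
        (Localization.AtPrime (Ideal.comap (Subring.inclusion h) (IsLocalRing.maximalIdeal O))) := by
  obtain ⟨R₁, hRR₁, hR₁O, hR₁fg, hfrac⟩ :=
    ShadowsUniformize.Negative.exists_fg_isFractionRing_le hfg O hk R hR hRO
  obtain ⟨A, h, hle, hAfg, hreg⟩ :=
    CossartPiltant2019LU3.relLocalUniformization hCP k K hK O R₁ hR₁fg hfrac hR₁O
  exact ⟨A, h, hRR₁.trans hle, hAfg, isFractionRing_of_le hle hfrac, hreg⟩

end Summit.ResolutionOfSingularities.ResolutionOfSingularities.Theorems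

end
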